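import Summits.BirchSwinnertonDyer.BirchSwinnertonDyer.Theorems.CMKolyvaginAtInertTwoSelmerRankOneMazurRubinPrimeR0AtTwo
import HarnessLib

/-!
# Route `CMKolyvaginAtInertTwo` (leaf `WAllCornerFTwo`, habitat H₂) — ON `#Sel₂(E) = 2` THE THREE FORMS OF THE OPEN INPUT AGREE PER CURVE:
# R0 at `E` (item 28176's body: all odd Heegner `K`, `Ш(E_K)(2) = ⊥` hypothesis) ⟺ `BSDp E 2` ⟺ R0 at the Mazur–Rubin primes of `E` (mod six prints)

Seat `bsd-line-cmk2-p1` g24 (cell `bsd-print-cf2`), `--supports stmt-BirchSwinnertonDyer-28176` (helper; closes nothing by name).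
THEOREMS ONLY (no definition, no named fact, no `sorry`).  BSD is NOT proved by this.

* `oneBitR0At_of_bsdp_of_printedInputs` — PER CURVE BSD-truth of R0: for `W ∈ H₂` (CM, `2` inert, `ρ̄₂` onto, `r_an = 1`, odd Tamagawa),
  `BSDp W 2` ∧ (GZ, GZK, modularity, Milne, Burungale–Flach) ⟹ for every imaginary quadratic `K` with odd `d_K ≠ −3` Heegner for `N_W`,
  every frame `(Dt, β, ι, d₁)` with `Dt.c` odd and `y_K` of infinite order: `Ш(W_K)(2) = ⊥ → y_K ∉ 2W(K[1])` (g23's p765765 per curve: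
  exact exponent `M₀`, the twin's BSD₂ by Burungale–Flach, g21's consistency identity `#Ш(W_K)(2) = 2^{2M₀}`).
* `R0At_of_mazurRubinPrimeR0_of_printedInputs` — on `#Sel₂(W) = 2` (framed `W`): R0 at the Mazur–Rubin primes of `W` ⟹ R0 at `W` for ALL `K`
  (through `BSDp W 2`, g24 p768389).  So restricting 28176 to Mazur–Rubin prime fields loses nothing per curve, modulo the prints.
* `bsdp_two_iff_R0At_of_printedInputs` — on `#Sel₂(W) = 2` (framed `W`): `BSDp W 2 ↔` R0 at `W` (all `K`).
Together with `bsdp_two_iff_mazurRubinPrimeR0_of_printedInputs` (p768389): R0_W ⟺ BSD₂(W) ⟺ R0ᴹᴿ_W on the cell.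

References: [GrossZagier1986] I (6.3), V §2; [BurungaleFlach2024] Cor. 2; [MazurRubin2010] Cor. 3.4 (i); [BurungaleTian2026] Thm. 1.1;
[Milne1972ArithmeticAV] Thm. 1; [Kramer1981] Prop. 3.
-/

set_option autoImplicit false
-- the Theorems namespace of this sub repeats the summit name by design (D-0017 nested layout)
set_option linter.dupNamespace false

noncomputable section

open scoped Classical

open WeierstrassCurve NumberField Literature.NumberTheory.EllipticCurves
  Literature.NumberTheory.EllipticCurves.ModularForms
  Literature.NumberTheory.EllipticCurves.Rank1Residual
  Summit.BirchSwinnertonDyer.Rank1Residual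
open Summit.BirchSwinnertonDyer.BirchSwinnertonDyer.Theorems.CMExactDescent

namespace Summit.BirchSwinnertonDyer.BirchSwinnertonDyer.Theorems.KolyvaginLowerTwo

/-- **PER-CURVE BSD-truth of R0**: `BSDp W 2` (with GZ, GZK, modularity, Milne any-model, Burungale–Flach) implies, for every odd Heegner `K`
(`d_K ≠ −3`) and every frame with odd `Dt.c` and `y_K` of infinite order, `Ш(W_K)(2) = ⊥ → y_K ∉ 2W(K[1])`.  (If `y_K = 2Q`, the exact exponent
`M₀ ≥ 1`; the twin has `L(W^{(d_K)},1) ≠ 0` by Gross–Zagier, hence a globally minimal CM model of analytic rank `0` with BSD₂ by Burungale–Flach;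
g21's identity `#Ш(W_K)(2) = 2^{2M₀}` then reads `1 = 2^{2M₀}`.)  The global form (leaf ⟹ 28176) is g23's p765765.
[cite: GrossZagier1986, I.6.3 and V.2] [cite: BurungaleFlach2024, Cor. 2] [cite: Milne1972ArithmeticAV, Thm. 1] -/
theorem oneBitR0At_of_bsdp_of_printedInputs
    (hGZ : ∀ (N : ℕ) [NeZero N] (W : WeierstrassCurve ℚ) (K : Type) [Field K] [NumberField K], gross_zagier N W K)
    (hGZK : rank_eq_analyticRank_of_analyticRank_le_one) (hnf : exists_isNewformOf)
    (hMilneC : Milne1972.bsdQuotient_baseChange_quadratic_anyModel) (hBF : bsdTriple_of_hasCM_of_L_one_ne_zero)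
    (W : WeierstrassCurve ℚ) [W.IsElliptic] [W.IsGloballyMinimal] [NeZero (W.conductorNorm ℤ)]
    (hCM : W.HasCM) (hρ2 : W.HasSurjectiveModNGaloisRep 2) (hr : W.analyticRank = 1) (hT : Odd W.tamagawaProduct) (hBW : BSDp W 2)
    (K : Type) [Field K] [NumberField K] (hIQ : IsImaginaryQuadratic K) (hodd : Odd (NumberField.discr K))
    (h3 : NumberField.discr K ≠ -3) (hHe : SatisfiesHeegnerHypothesis (W.conductorNorm ℤ) K)
    (Dt : ModularParametrizationData W (W.conductorNorm ℤ)) (hc : Odd Dt.c) (β : ℤ) (ι : K →+* ℂ)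
    (d₁ : KolyvaginHeegnerData Dt β ι 1) (hy : ¬ IsOfFinAddOrder d₁.derivedPoint)
    (hsha : AddCommGroup.primaryComponent (W.baseChange K).sha 2 = ⊥) :
    ¬ ∃ Q : (W.baseChange (ringClassField K ι 1)).toAffine.Point, (2 : ℤ) • Q = d₁.derivedPoint := by
  rintro ⟨Q, hQ⟩
  have hmod : hasEntireLFunction_rat := hasEntireLFunction_rat_of_exists_isNewformOf hnf
  -- the exact `2`-divisibility exponent `M₀` of `y_K = P(1)` in `E(K[1])`
  haveI : NumberField (ringClassField K ι 1) := numberField_ringClassField hIQ ι one_ne_zero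
  haveI : (W.baseChange (ringClassField K ι 1)).IsElliptic := by rw [baseChange]; infer_instance
  haveI : Module.Finite ℤ (W.baseChange (ringClassField K ι 1)).toAffine.Point := by
    convert (W.baseChange (ringClassField K ι 1)).module_finite_point_holds
  obtain ⟨M₀, hdiv, hndiv⟩ := exists_pow_smul_eq_and_not_of_not_isOfFinAddOrder Nat.prime_two hy
  -- the twin has `L(E^{(d_K)}, 1) ≠ 0` (Gross–Zagier: `y_K` non-torsion)
  obtain ⟨P₀, Hd, hP₀, hP₀K⟩ := exists_heegnerPoint_map_eq_derivedPoint_one hIQ hHe d₁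
  have hPinf : ¬ IsOfFinAddOrder P₀ := by
    intro hfin
    apply hy
    rw [← hP₀K]
    exact (WeierstrassCurve.Affine.Point.map (W' := W) (algebraMap K (ringClassField K ι 1)).toRatAlgHom).isOfFinAddOrder hfin
  have hLK : LDerivEK W K ≠ 0 :=
    (lDerivEK_ne_zero_iff_not_isOfFinAddOrder W (W.conductorNorm ℤ) K (hGZ _ W K) hIQ hHe ⟨Dt, Hd, ι, hP₀⟩).mpr hPinf
  have hL0 : W.entireLFunction 1 = 0 := entireLFunction_one_eq_zero_of_analyticRank_eq_one hr
  have hLt : (W.quadraticTwist (NumberField.discr K : ℚ)).entireLFunction 1 ≠ 0 := by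
    intro h0
    apply hLK
    rw [Literature.NumberTheory.EllipticCurves.KrizLi2019.lDerivEK_eq_deriv_mul W K hmod hL0, h0, mul_zero]
  -- the globally minimal CM twin of analytic rank `0`; BSD₂ of the twin from PRINT
  obtain ⟨Wd, _, _, hWd, hcmd, hrd⟩ := CMSupply.exists_minimal_twin_hasCM_analyticRank_zero hnf W hCM K hLt
  have hBd : BSDp Wd 2 := Summit.BirchSwinnertonDyer.Rank1Residual.bsdp_cm_rankZero (p := 2) hBF hmod hcmd hrd
  -- g21: `#Ш(E_K)(2) = 2^{2M₀}`; with `Ш(E_K)(2) = ⊥` this is `1 = 2^{2M₀}`, so `M₀ = 0`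
  have hcard := KolyvaginGenusTwo.card_primaryComponent_sha_two_baseChange_eq_pow_of_bsdp_of_printedInputs hGZ hGZK hmod hMilneC W hρ2
    hr hT K hIQ hodd h3 hHe Dt hc β ι d₁ hy M₀ hdiv hndiv Wd hWd hBd hBW
  rw [hsha, AddSubgroup.card_bot] at hcard
  have hM : M₀ = 0 := by
    have h := (Nat.pow_eq_one.mp hcard.symm).resolve_left (by norm_num)
    omega
  subst hM
  exact hndiv ⟨Q, by simpa using hQ⟩

/-- **On `#Sel₂(E) = 2`: R0 at the Mazur–Rubin primes ⟹ R0 at `E` for ALL odd Heegner `K`** (framed `W ∈ H₂`; six prints: GZ, GZK, modularity,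
Milne, Burungale–Flach, Burungale–Tian).  Through `BSDp W 2` (`bsdp_two_of_natCard_selmerGroup_eq_two_of_mazurRubinPrimeR0_of_printedInputs`) and the
per-curve BSD-truth above.  So restricting item 28176 to Mazur–Rubin prime fields loses nothing per curve (mod prints). [cite: MazurRubin2010, Cor. 3.4 (i)]
[cite: BurungaleTian2026, Thm. 1.1] [cite: BurungaleFlach2024, Cor. 2] -/
theorem R0At_of_mazurRubinPrimeR0_of_printedInputs
    (hGZ : ∀ (N : ℕ) [NeZero N] (W : WeierstrassCurve ℚ) (K : Type) [Field K] [NumberField K], gross_zagier N W K)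
    (hGZK : rank_eq_analyticRank_of_analyticRank_le_one) (hnf : exists_isNewformOf)
    (hMilneC : Milne1972.bsdQuotient_baseChange_quadratic_anyModel) (hBF : bsdTriple_of_hasCM_of_L_one_ne_zero)
    (hBT : burungaleTian_analyticRank_eq_zero_of_selmerCorank_eq_zero_of_hasCM)
    (W : WeierstrassCurve ℚ) [W.IsElliptic] [W.IsGloballyMinimal] [NeZero (W.conductorNorm ℤ)]
    (hCM : W.HasCM) (hin : Rank1Residual.CMInert W 2) (hρ2 : W.HasSurjectiveModNGaloisRep 2) (hr : W.analyticRank = 1)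
    (hT : Odd W.tamagawaProduct)
    (hopt : ∃ Dt : ModularParametrizationData W (W.conductorNorm ℤ),
      (∀ z ∈ Dt.L.lattice, ∃ w ∈ periodLattice Dt.f, z = (Dt.c : ℂ) * w) ∧ Odd Dt.c)
    (hSel : Nat.card (W.selmerGroup 2) = 2)
    (hR0MR : ∀ (ℓ : ℕ) [Fact ℓ.Prime], ℓ % 8 = 7 → (4 * W.conductorNorm ℤ : ℕ) ∣ ℓ + 1 →
      ¬ W.selmerGroup 2 ≤ MazurRubin2010.strictLocalKer W ℚ_[ℓ] 2 →
      ∀ (K : Type) [Field K] [NumberField K], IsImaginaryQuadratic K → NumberField.discr K = -(ℓ : ℤ) →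
      SatisfiesHeegnerHypothesis (W.conductorNorm ℤ) K → ((Ideal.span {(2 : ℤ)}).primesOver (𝓞 K)).ncard = 2 →
      ∀ (Dt : ModularParametrizationData W (W.conductorNorm ℤ)),
      (∀ z ∈ Dt.L.lattice, ∃ w ∈ periodLattice Dt.f, z = (Dt.c : ℂ) * w) → Odd Dt.c →
      ∀ (β : ℤ) (ι : K →+* ℂ) (d₁ : KolyvaginHeegnerData Dt β ι 1), ¬ IsOfFinAddOrder d₁.derivedPoint →
      ¬ ∃ Q : (W.baseChange (ringClassField K ι 1)).toAffine.Point, (2 : ℤ) • Q = d₁.derivedPoint)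
    (K : Type) [Field K] [NumberField K] (hIQ : IsImaginaryQuadratic K) (hodd : Odd (NumberField.discr K))
    (h3 : NumberField.discr K ≠ -3) (hHe : SatisfiesHeegnerHypothesis (W.conductorNorm ℤ) K)
    (Dt : ModularParametrizationData W (W.conductorNorm ℤ)) (hc : Odd Dt.c) (β : ℤ) (ι : K →+* ℂ)
    (d₁ : KolyvaginHeegnerData Dt β ι 1) (hy : ¬ IsOfFinAddOrder d₁.derivedPoint)
    (hsha : AddCommGroup.primaryComponent (W.baseChange K).sha 2 = ⊥) :
    ¬ ∃ Q : (W.baseChange (ringClassField K ι 1)).toAffine.Point, (2 : ℤ) • Q = d₁.derivedPoint :=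
  oneBitR0At_of_bsdp_of_printedInputs hGZ hGZK hnf hMilneC hBF W hCM hρ2 hr hT
    (bsdp_two_of_natCard_selmerGroup_eq_two_of_mazurRubinPrimeR0_of_printedInputs hGZ hGZK hnf hMilneC hBF hBT W hCM hin hρ2 hr hT hopt hSel
      hR0MR)
    K hIQ hodd h3 hHe Dt hc β ι d₁ hy hsha

/-- **On `#Sel₂(E) = 2`: `BSDp W 2 ↔` R0 at `W` for all odd Heegner `K`** (framed `W ∈ H₂`; six prints).  (→) the per-curve BSD-truth; (←) g24's
`bsdp_two_of_natCard_selmerGroup_eq_two_of_oneBitR0At_of_printedInputs` (only one-bit fields are used).  With p768389's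
`bsdp_two_iff_mazurRubinPrimeR0_of_printedInputs`: R0_W ⟺ BSD₂(W) ⟺ R0ᴹᴿ_W on the cell.  BSD is NOT proved by this.
[cite: MazurRubin2010, Cor. 3.4 (i)] [cite: BurungaleTian2026, Thm. 1.1] [cite: BurungaleFlach2024, Cor. 2] [cite: GrossZagier1986, V.§2] -/
theorem bsdp_two_iff_R0At_of_printedInputs
    (hGZ : ∀ (N : ℕ) [NeZero N] (W : WeierstrassCurve ℚ) (K : Type) [Field K] [NumberField K], gross_zagier N W K)
    (hGZK : rank_eq_analyticRank_of_analyticRank_le_one) (hnf : exists_isNewformOf)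
    (hMilneC : Milne1972.bsdQuotient_baseChange_quadratic_anyModel) (hBF : bsdTriple_of_hasCM_of_L_one_ne_zero)
    (hBT : burungaleTian_analyticRank_eq_zero_of_selmerCorank_eq_zero_of_hasCM)
    (W : WeierstrassCurve ℚ) [W.IsElliptic] [W.IsGloballyMinimal] [NeZero (W.conductorNorm ℤ)]
    (hCM : W.HasCM) (hin : Rank1Residual.CMInert W 2) (hρ2 : W.HasSurjectiveModNGaloisRep 2) (hr : W.analyticRank = 1)
    (hT : Odd W.tamagawaProduct)
    (hopt : ∃ Dt : ModularParametrizationData W (W.conductorNorm ℤ),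
      (∀ z ∈ Dt.L.lattice, ∃ w ∈ periodLattice Dt.f, z = (Dt.c : ℂ) * w) ∧ Odd Dt.c)
    (hSel : Nat.card (W.selmerGroup 2) = 2) :
    BSDp W 2 ↔
      ∀ (K : Type) [Field K] [NumberField K], IsImaginaryQuadratic K → Odd (NumberField.discr K) →
        NumberField.discr K ≠ -3 → SatisfiesHeegnerHypothesis (W.conductorNorm ℤ) K →
        ∀ (Dt : ModularParametrizationData W (W.conductorNorm ℤ)),
        (∀ z ∈ Dt.L.lattice, ∃ w ∈ periodLattice Dt.f, z = (Dt.c : ℂ) * w) → Odd Dt.c →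
        ∀ (β : ℤ) (ι : K →+* ℂ) (d₁ : KolyvaginHeegnerData Dt β ι 1), ¬ IsOfFinAddOrder d₁.derivedPoint →
        AddCommGroup.primaryComponent (W.baseChange K).sha 2 = ⊥ →
        ¬ ∃ Q : (W.baseChange (ringClassField K ι 1)).toAffine.Point, (2 : ℤ) • Q = d₁.derivedPoint :=
  ⟨fun hBW K _ _ hIQ hodd h3 hHe Dt _ hc β ι d₁ hy hsha ↦
      oneBitR0At_of_bsdp_of_printedInputs hGZ hGZK hnf hMilneC hBF W hCM hρ2 hr hT hBW K hIQ hodd h3 hHe Dt hc β ι d₁ hy hsha,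
    fun h ↦ bsdp_two_of_natCard_selmerGroup_eq_two_of_oneBitR0At_of_printedInputs hGZ hGZK hnf hMilneC hBF hBT W hCM hin hρ2 hr hT hopt hSel
      (fun K _ _ hK hodd h3 hH _ Dt hDt hc β ι d₁ hy hbot ↦ h K hK hodd h3 hH Dt hDt hc β ι d₁ hy hbot)⟩

end Summit.BirchSwinnertonDyer.BirchSwinnertonDyer.Theorems.KolyvaginLowerTwo

end
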